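import Literature.Probability.RandomPlanarGeometry.SAWAllTurnUnfoldConcat
import Literature.Probability.RandomPlanarGeometry.SAWAllTurnReroot
import Literature.Probability.RandomPlanarGeometry.SAWBendingEnergyBridges
import HarnessLib

/-!
# The all-turn Hammersley–Welsh bound: `b^{AT}(2m) ≥ e^{-16√m} μ_AT^{2m}` («L-POLY» K1, with S1 and S4)

Topic `Literature/Probability/RandomPlanarGeometry` (continues `SAWAllTurnUnfoldConcat.lean` — a-p6: the all-turn
objects `allTurnWalksV / allTurnCountV`, `allTurnBridges / allTurnBridgeCount = b^{AT}`,
`allTurnHalfSpaceWalks / allTurnHalfSpaceCount = h^{AT}` and the supports S5 `allTurnUnfold`, S6 `allTurnConcat` —,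
`SAWAllTurnReroot.lean` (step types on all-turn words) and `SAWBendingEnergyBridges.lean` (a-p4: the step words of
the Hammersley–Welsh maps, `wordOf_headWalk` / `wordOf_tailWalk`)). Lane «pcv-sawmu», a-idea-2's
`Sketch_v9_LPOLY.lean` (481736c9): the all-turn (L-lattice) Hammersley theorem `lim (1/4n) log q(4n) = log μ_AT`;
this file closes its crux **K1 `AllTurnHW`** — Madras–Slade's Corollary 3.1.6 (`b_n ≥ e^{-c√n} μ^n`) run INSIDE the
class of all-turn walks (every internal vertex a right angle), along EVEN lengths:

* `muAT := exp logMuAT` (Sketch_v9 body verbatim);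
* S1 **`allTurnSwap : ∀ N ≥ 1, 2 a_V(N) = a(N)`** — the coordinate swap (`swapL` on letters, `swapXY` on sites);
* S4 **`allTurnHWSplit`** — for ODD `N`, `a_V(N) ≤ Σ_{m odd} h^{AT}(m+1) h^{AT}(N-m)`: the split at the last minimum
  of the first coordinate lands at an ODD time (`odd_lastMin_of_allTurnWalksV`: the next step is `+e₁`, horizontal,
  and horizontal steps sit at even times), so the head piece (`+e₁`, then the reversed prefix) and the tail piece are
  all-turn (`turns_headWalk_of_allTurnWalksV`, `turns_tailWalk_of_allTurn`) of even lengths;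
* **K1 `allTurnHW : ∃ c, ∀ m, e^{-c√m} μ_AT^{2m} ≤ b^{AT}(2m)`** (with `c = 16`):
  `μ_AT^{2m-1} ≤ a(2m-1) = 2a_V(2m-1) ≤ 4m e^{6√(2m)} b^{AT}(2m)` by S1, S4, S5, S6 (`muAT_pow_le_allTurnCount`).
[cite: MadrasSlade1993, §3.1: Theorem 3.1.1, eq. (3.1.7), Proposition 3.1.5, Corollary 3.1.6]
-/

noncomputable section

namespace Literature.Probability.RandomPlanarGeometry.SAW

open Finset Filter Topology Literature.Probability.LatticeModels Literature.Probability.Percolation SimpleGraph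
open scoped BigOperators

/-! ### Words of self-avoiding walks (plumbing) -/

/-- In an all-turn word all consecutive letters differ (private copy). [cite: MadrasSlade1993, §1.1] -/
private theorem consec_ne_of_allTurn' : ∀ (w : List Step), wturns w = w.length - 1 →
    ∀ (i : ℕ) (h : i + 1 < w.length), w[i] ≠ w[i + 1]
  | [], _, i, h => by simp at h
  | [a], _, i, h => by simp at h
  | a :: b :: w, hw, i, h => by
    have hle := wturns_le_length_sub_one (b :: w)
    simp only [wturns_cons_cons, List.length_cons] at hw hle
    have hab : a ≠ b := by
      by_contra hab
      rw [if_pos hab] at hw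
      omega
    rw [if_neg hab] at hw
    rcases i with _ | i
    · simpa using hab
    · have ih := consec_ne_of_allTurn' (b :: w) (by simp only [List.length_cons]; omega) i (by simpa using h)
      simpa using ih

/-- If all consecutive letters differ, the word is all-turn (private copy). [cite: MadrasSlade1993, §1.1] -/
private theorem allTurn_of_consec_ne' : ∀ (w : List Step),
    (∀ (i : ℕ) (h : i + 1 < w.length), w[i] ≠ w[i + 1]) → wturns w = w.length - 1
  | [], _ => rfl
  | [a], _ => rfl
  | a :: b :: w, h => by
    have hab : a ≠ b := h 0 (by simp)
    have ih := allTurn_of_consec_ne' (b :: w) fun i hi => h (i + 1) (by simpa using hi)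
    rw [wturns_cons_cons, if_neg hab, ih]
    simp only [List.length_cons]
    omega

/-- The word of a self-avoiding walk is self-avoiding. [cite: MadrasSlade1993, §1.1] -/
theorem isSAW_wordOf {n : ℕ} {ω : ℕ → Site 2} (hω : ω ∈ Zd.saws 2 n) : IsSAW (wordOf n ω) := by
  rw [isSAW_iff_injOn, traj_wordOf hω, length_wordOf]
  exact (Zd.mem_saws.1 hω).2.2.2

/-- The word of an all-turn self-avoiding walk is an all-turn word. [cite: MadrasSlade1993, §1.1] -/
theorem wordOf_mem_allTurnWords {n : ℕ} {ω : ℕ → Site 2} (hω : ω ∈ Zd.saws 2 n) (ht : Zd.turns n ω = n - 1) :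
    wordOf n ω ∈ allTurnWords n :=
  mem_allTurnWords.2 ⟨length_wordOf n ω, isSAW_wordOf hω, by rw [← turns_eq_wturns_wordOf hω]; exact ht⟩

/-- A letter with `dx > 0` is `+e₁`. [folklore] -/
private theorem Step.eq_zero_of_dx {a : Step} (h : 0 < Step.dx a) : a = 0 := by
  revert a h; decide

/-- `typ 0 = 0`. [folklore] -/
private theorem typ_zero : Step.typ 0 = 0 := by decide

/-- `typ (a + 2) = typ a`. [folklore] -/
private theorem typ_add_two (a : Step) : (a + 2).typ = a.typ := by revert a; decide

end Literature.Probability.RandomPlanarGeometry.SAW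

namespace Literature.Probability.RandomPlanarGeometry.SAW.Zd

open Finset Filter Topology Literature.Probability.LatticeModels Literature.Probability.Percolation SimpleGraph
open scoped BigOperators
open Literature.Probability.RandomPlanarGeometry.SAW

/-! ### The all-turn growth constant -/

/-- `μ_AT = exp(log μ_AT)` (a-idea-2 `Sketch_v9_LPOLY.lean`, body verbatim; the all-turn objects `allTurnWalksV`,
`allTurnBridges`, `allTurnHalfSpaceWalks` and their counts are those of `SAWAllTurnUnfoldConcat.lean`).
[cite: MadrasSlade1993, §1.2] -/
noncomputable def muAT : ℝ := Real.exp Zd.logMuAT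

/-! ### S4 `AllTurnHWSplit` — the parity-clean Hammersley–Welsh split -/

/-- For a walk with a vertical first step, the first letter of its word is vertical. [cite: MadrasSlade1993, §1.1] -/
private theorem typ_wordOf_zero_of_vertical {N : ℕ} {ω : ℕ → Site 2} (hω : ω ∈ saws 2 N) (hN : 0 < N)
    (hv : ω 1 0 = 0) : ((wordOf N ω)[0]'(by simp [hN])).typ = 1 := by
  rw [Step.typ_eq_one_iff]
  have h := apply_succ_eq_add_vec_wordOf hω hN
  rw [(mem_saws.1 hω).1, zero_add] at h
  simp only [zero_add] at h
  rw [← h]; exact hv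

/-- **Parity lemma**: for an all-turn walk of ODD length with a vertical first step, the last minimum `m` of the
first coordinate is ODD (the step after it is `+e₁`, a horizontal step, and horizontal steps sit at even times;
if `m = N`, `N` is odd). [cite: MadrasSlade1993, §3.1 (proof of Theorem 3.1.1), all-turn edition] -/
theorem odd_lastMin_of_allTurnWalksV {N : ℕ} {ω : ℕ → Site 2} (hN : Odd N) (hω : ω ∈ allTurnWalksV N) :
    Odd (lastMin N ω) := by
  rw [allTurnWalksV, Finset.mem_filter] at hω
  obtain ⟨hs, ht, hv⟩ := hω
  have hN0 : 0 < N := hN.pos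
  obtain ⟨m, hm⟩ : ∃ m, lastMin N ω = m := ⟨_, rfl⟩
  have hmN : m ≤ N := hm ▸ lastMin_le N ω
  rw [hm]
  rcases hmN.lt_or_eq with hlt | heq
  · have hW := wordOf_mem_allTurnWords hs ht
    have h0 := typ_wordOf_zero_of_vertical hs hN0 hv
    have hx : ω m 0 < ω (m + 1) 0 := by
      have := apply_lastMin_lt (n := N) (ω := ω) (i := m + 1) (by omega) (by omega)
      rwa [hm] at this
    have hstep := apply_succ_eq_add_vec_wordOf hs hlt
    have hWm : (wordOf N ω)[m]'(by simp [hlt]) = 0 := by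
      apply Step.eq_zero_of_dx
      have := congrFun hstep 0
      simp only [Pi.add_apply, Step.vec_apply_zero] at this
      linarith
    have htyp := typ_getElem_of_mem_allTurnWords hW m (by simp [hlt])
    rw [hWm, h0, typ_zero] at htyp
    rw [Nat.odd_iff]; omega
  · rw [heq]; exact hN

/-- **The head piece of the split of an all-turn walk (at an odd last minimum) is all-turn.**
[cite: MadrasSlade1993, §3.1 (proof of Theorem 3.1.1), all-turn edition] -/
theorem turns_headWalk_of_allTurnWalksV {N : ℕ} {ω : ℕ → Site 2} (hN : Odd N) (hω : ω ∈ allTurnWalksV N) :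
    turns (lastMin N ω + 1) (headWalk N ω) = lastMin N ω := by
  have hodd := odd_lastMin_of_allTurnWalksV hN hω
  rw [allTurnWalksV, Finset.mem_filter] at hω
  obtain ⟨hs, ht, hv⟩ := hω
  have hN0 : 0 < N := hN.pos
  set m := lastMin N ω with hm
  have hmN : m ≤ N := lastMin_le N ω
  have hm1 : 1 ≤ m := hodd.pos
  have hH : headWalk N ω ∈ saws 2 (m + 1) := (mem_halfSpaceWalks.1 (headWalk_mem hs)).1
  rw [turns_eq_wturns_wordOf hH, wordOf_headWalk hs]
  have hW := wordOf_mem_allTurnWords hs ht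
  have hWl : (wordOf N ω).length = N := length_wordOf N ω
  have hall := consec_ne_of_allTurn' (wordOf N ω) (by rw [hWl, ← turns_eq_wturns_wordOf hs]; exact ht)
  have h0 := typ_wordOf_zero_of_vertical hs hN0 hv
  set L := ((wordOf N ω).take m).reverse.map (fun a => a + 2) with hL
  have hLl : L.length = m := by simp [hL, hWl, min_eq_left hmN]
  have hlen : ((0 : Step) :: L).length = m + 1 := by simp [hLl]
  rw [show m = ((0 : Step) :: L).length - 1 by rw [hlen]; rfl]
  refine allTurn_of_consec_ne' _ fun i hi => ?_
  rw [hlen] at hi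
  -- letters of the head word: `0`, then `W[m-1]+2, W[m-2]+2, …, W[0]+2`
  have eL : ∀ (k : ℕ) (hk : k < m), L[k]'(by rw [hLl]; exact hk) = (wordOf N ω)[m - 1 - k]'(by omega) + 2 := by
    intro k hk
    simp only [hL, List.getElem_map, List.getElem_reverse, List.getElem_take, List.length_take, hWl,
      min_eq_left hmN]
  rcases Nat.eq_zero_or_pos i with rfl | hipos
  · -- `0` versus `W[m-1] + 2` (vertical, since `m` is odd)
    rw [List.getElem_cons_zero, List.getElem_cons_succ, eL 0 (by omega)]
    have htyp := typ_getElem_of_mem_allTurnWords hW (m - 1 - 0) (by omega)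
    rw [h0] at htyp
    refine Step.ne_of_typ_ne ?_
    rw [typ_zero, typ_add_two, htyp]
    rcases hodd with ⟨r, hr⟩
    omega
  · obtain ⟨i', rfl⟩ : ∃ i', i = i' + 1 := ⟨i - 1, by omega⟩
    rw [List.getElem_cons_succ, List.getElem_cons_succ, eL i' (by omega), eL (i' + 1) (by omega)]
    have := hall (m - 1 - (i' + 1)) (by omega)
    have e : m - 1 - (i' + 1) + 1 = m - 1 - i' := by omega
    simp only [e] at this
    intro h
    exact this.symm (add_right_cancel h)

/-- **The tail piece of the split of an all-turn walk is all-turn.** [cite: MadrasSlade1993, §3.1 (proof of Theorem 3.1.1), all-turn edition] -/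
theorem turns_tailWalk_of_allTurn {N : ℕ} {ω : ℕ → Site 2} (hs : ω ∈ saws 2 N) (ht : turns N ω = N - 1) :
    turns (N - lastMin N ω) (tailWalk N ω) = N - lastMin N ω - 1 := by
  set m := lastMin N ω with hm
  have hmN : m ≤ N := lastMin_le N ω
  have hT : tailWalk N ω ∈ saws 2 (N - m) := (mem_halfSpaceWalks.1 (tailWalk_mem hs)).1
  rw [turns_eq_wturns_wordOf hT, wordOf_tailWalk hs]
  have hWl : (wordOf N ω).length = N := length_wordOf N ω
  have hall := consec_ne_of_allTurn' (wordOf N ω) (by rw [hWl, ← turns_eq_wturns_wordOf hs]; exact ht)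
  have hlen : ((wordOf N ω).drop m).length = N - m := by simp [hWl]
  rw [← hlen]
  refine allTurn_of_consec_ne' _ fun i hi => ?_
  rw [hlen] at hi
  rw [List.getElem_drop, List.getElem_drop]
  have := hall (m + i) (by omega)
  have e : m + i + 1 = m + (i + 1) := by omega
  simp only [e] at this
  exact this

/-- **S4 `AllTurnHWSplit`** (the parity-clean all-turn edition of Madras–Slade (3.1.7)): for ODD `N`,
`a_V(N) ≤ Σ_{m odd} h^{AT}(m+1) · h^{AT}(N-m)` — cut at the last minimum `m` of the first coordinate (odd), the
head piece (`+e₁`, then the reversed prefix) and the tail piece are all-turn half-space walks of even lengths,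
and `ω` is recovered from them and `m`. [cite: MadrasSlade1993, §3.1, eq. (3.1.7)] -/
theorem allTurnHWSplit : ∀ N : ℕ, Odd N →
    allTurnCountV N ≤
      ∑ m ∈ (Finset.range (N + 1)).filter Odd, allTurnHalfSpaceCount (m + 1) * allTurnHalfSpaceCount (N - m) := by
  classical
  intro N hN
  have hcard : (((Finset.range (N + 1)).filter Odd).sigma
      fun m => allTurnHalfSpaceWalks (m + 1) ×ˢ allTurnHalfSpaceWalks (N - m)).card =
      ∑ m ∈ (Finset.range (N + 1)).filter Odd, allTurnHalfSpaceCount (m + 1) * allTurnHalfSpaceCount (N - m) := by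
    rw [Finset.card_sigma]
    simp_rw [Finset.card_product]
    rfl
  rw [allTurnCountV, ← hcard]
  refine Finset.card_le_card_of_injOn
    (fun ω => (⟨lastMin N ω, (headWalk N ω, tailWalk N ω)⟩ : Σ _ : ℕ, (ℕ → Site 2) × (ℕ → Site 2))) ?_ ?_
  · intro ω hω
    rw [Finset.mem_coe] at hω
    have hωV := hω
    rw [allTurnWalksV, Finset.mem_filter] at hω
    obtain ⟨hs, ht, hv⟩ := hω
    rw [Finset.mem_coe, Finset.mem_sigma, Finset.mem_filter, Finset.mem_range, Finset.mem_product]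
    refine ⟨⟨Nat.lt_succ_of_le (lastMin_le N ω), odd_lastMin_of_allTurnWalksV hN hωV⟩, ?_, ?_⟩
    · exact Finset.mem_filter.2 ⟨headWalk_mem hs, turns_headWalk_of_allTurnWalksV hN hωV⟩
    · exact Finset.mem_filter.2 ⟨tailWalk_mem hs, turns_tailWalk_of_allTurn hs ht⟩
  · intro ω hω ω' hω' h
    rw [Finset.mem_coe, allTurnWalksV, Finset.mem_filter] at hω hω'
    replace hω := hω.1
    replace hω' := hω'.1
    simp only [Sigma.mk.inj_iff] at h
    obtain ⟨hmm, h⟩ := h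
    have h' : (headWalk N ω, tailWalk N ω) = (headWalk N ω', tailWalk N ω') := eq_of_heq h
    simp only [Prod.mk.injEq] at h'
    obtain ⟨hh, htt⟩ := h'
    obtain ⟨h0, hend, hadj, hinj⟩ := mem_saws.1 hω
    obtain ⟨h0', hend', hadj', hinj'⟩ := mem_saws.1 hω'
    obtain ⟨m, hm⟩ : ∃ m, lastMin N ω = m := ⟨_, rfl⟩
    have hm' : lastMin N ω' = m := hmm.symm.trans hm
    have hmn : m ≤ N := hm ▸ lastMin_le N ω
    have hωm : ω m = ω' m := by
      have := congrFun hh (m + 1)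
      rw [headWalk_apply hm, headWalk_apply hm', if_neg (by omega), if_neg (by omega), min_self,
        Nat.sub_self, h0, h0', add_left_inj, zero_sub, zero_sub, neg_inj] at this
      exact this
    funext i
    rcases le_or_gt i m with hi | hi
    · rcases Nat.eq_zero_or_pos (m - i) with h | h
      · have : i = m := by omega
        rw [this, hωm]
      · have := congrFun hh (m + 1 - i)
        rw [headWalk_apply hm, headWalk_apply hm', if_neg (by omega), if_neg (by omega),
          min_eq_left (by omega : m + 1 - i ≤ m + 1), show m + 1 - (m + 1 - i) = i by omega,
          hωm, add_left_inj, sub_left_inj] at this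
        exact this
    · rcases le_or_gt i N with hin | hin
      · have := congrFun htt (i - m)
        rw [tailWalk_apply hm, tailWalk_apply hm', min_eq_left (by omega : i - m ≤ N - m),
          show m + (i - m) = i by omega, hωm, sub_left_inj] at this
        exact this
      · have := congrFun htt (N - m)
        rw [tailWalk_apply hm, tailWalk_apply hm', min_self, show m + (N - m) = N by omega, hωm,
          sub_left_inj] at this
        rw [hend i hin.le, hend' i hin.le, this]

/-! ### S1 `AllTurnSwap` — the coordinate swap -/

/-- The letter swap `+e₁ ↔ +e₂`, `−e₁ ↔ −e₂` (the coordinate swap `(x, y) ↦ (y, x)` on steps). [cite: MadrasSlade1993, §1.1 (lattice symmetries)] -/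
def swapL (a : Step) : Step := if a = 0 then 1 else if a = 1 then 0 else if a = 2 then 3 else 2

/-- `swapL` is an involution. [folklore] -/
private theorem swapL_swapL (a : Step) : swapL (swapL a) = a := by revert a; decide

/-- `swapL` is injective. [folklore] -/
private theorem swapL_injective : Function.Injective swapL := by
  intro a b h; have := congrArg swapL h; rwa [swapL_swapL, swapL_swapL] at this

/-- `swapL` exchanges the two types. [folklore] -/
private theorem typ_swapL (a : Step) : (swapL a).typ = 1 - a.typ := by revert a; decide

/-- `dx (swapL a) = dy a`. [folklore] -/
private theorem dx_swapL (a : Step) : Step.dx (swapL a) = Step.dy a := by revert a; decide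

/-- `dy (swapL a) = dx a`. [folklore] -/
private theorem dy_swapL (a : Step) : Step.dy (swapL a) = Step.dx a := by revert a; decide

/-- The coordinate swap of `ℤ²`. [cite: MadrasSlade1993, §1.1 (lattice symmetries)] -/
def swapXY (p : Site 2) : Site 2 := ![p 1, p 0]

/-- `swapXY` is additive. [folklore] -/
private theorem swapXY_add (p q : Site 2) : swapXY (p + q) = swapXY p + swapXY q := by
  funext j; fin_cases j <;> simp [swapXY]

/-- `swapXY 0 = 0`. [folklore] -/
private theorem swapXY_zero : swapXY (0 : Site 2) = 0 := by
  funext j; fin_cases j <;> simp [swapXY]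

/-- `swapXY` is injective. [folklore] -/
private theorem swapXY_injective : Function.Injective swapXY := by
  intro p q h
  funext j
  fin_cases j
  · have := congrFun h 1; simpa [swapXY] using this
  · have := congrFun h 0; simpa [swapXY] using this

/-- `vec (swapL a) = swapXY (vec a)`. [folklore] -/
private theorem vec_swapL (a : Step) : Step.vec (swapL a) = swapXY (Step.vec a) := by
  funext j
  fin_cases j
  · simp [swapXY, dx_swapL]
  · simp [swapXY, dy_swapL]

/-- Endpoint of the swapped word. [folklore] -/
private theorem wEnd_map_swapL : ∀ w : List Step, wEnd (w.map swapL) = swapXY (wEnd w)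
  | [] => by simp [swapXY_zero]
  | a :: w => by rw [List.map_cons, wEnd_cons, wEnd_cons, wEnd_map_swapL w, vec_swapL, swapXY_add]

/-- Trajectory of the swapped word. [folklore] -/
private theorem traj_map_swapL (w : List Step) (i : ℕ) : traj (w.map swapL) i = swapXY (traj w i) := by
  simp only [traj, ← List.map_take, wEnd_map_swapL]

/-- The swap maps all-turn self-avoiding words to all-turn self-avoiding words. [cite: MadrasSlade1993, §1.1 (lattice symmetries)] -/
theorem map_swapL_mem_allTurnWords {N : ℕ} {w : List Step} (hw : w ∈ allTurnWords N) :
    w.map swapL ∈ allTurnWords N := by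
  obtain ⟨hl, hs, ht⟩ := mem_allTurnWords.1 hw
  refine mem_allTurnWords.2 ⟨by simp [hl], ?_, by rw [wturns_map swapL_injective, ht]⟩
  rw [isSAW_iff_injOn] at hs ⊢
  intro i hi j hj hij
  simp only [Set.mem_setOf_eq, List.length_map] at hi hj
  rw [traj_map_swapL, traj_map_swapL] at hij
  exact hs hi hj (swapXY_injective hij)

/-- `a_V(N)` counted on words: the all-turn words whose first letter is vertical. [cite: MadrasSlade1993, §1.1 and §3.1] -/
theorem allTurnCountV_eq_card (N : ℕ) (hN : 0 < N) :
    allTurnCountV N = ((allTurnWords N).filter fun w => (w.getD 0 0).typ = 1).card := by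
  classical
  rw [allTurnCountV, allTurnWalksV, ← image_traj_sawWords, Finset.filter_image, allTurnWords, Finset.filter_filter]
  rw [Finset.card_image_of_injOn]
  · congr 1
    refine Finset.filter_congr fun w hw => ?_
    have hl := (mem_sawWords.1 hw).1
    rw [turns_traj hl]
    refine and_congr Iff.rfl ?_
    have hw0 : 0 < w.length := by omega
    have e : traj w 1 = Step.vec (w[0]'hw0) := by
      rw [traj_succ w hw0, traj_zero, zero_add]
    rw [e, Step.vec_apply_zero, List.getD_eq_getElem _ _ hw0, Step.typ_eq_one_iff, Step.vec_apply_zero]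
  · intro w hw w' hw' h
    have hl : w.length = N := (mem_sawWords.1 (Finset.mem_filter.1 (Finset.mem_coe.1 hw)).1).1
    have hl' : w'.length = N := (mem_sawWords.1 (Finset.mem_filter.1 (Finset.mem_coe.1 hw')).1).1
    exact traj_injOn N (by simp [hl]) (by simp [hl']) h

/-- **S1 `AllTurnSwap`: `2 a_V(N) = a(N)` for `N ≥ 1`** — the coordinate swap is a bijection of the all-turn walks
exchanging "first step vertical" and "first step horizontal". [cite: MadrasSlade1993, §1.1 (lattice symmetries)] -/
theorem allTurnSwap : ∀ N : ℕ, 1 ≤ N → 2 * allTurnCountV N = allTurnCount N := by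
  classical
  intro N hN
  rw [allTurnCountV_eq_card N hN, allTurnCount_eq_card_allTurnWords]
  set V := (allTurnWords N).filter fun w => (w.getD 0 0).typ = 1 with hV
  set H := (allTurnWords N).filter fun w => ¬ (w.getD 0 0).typ = 1 with hH
  have hsplit : V.card + H.card = (allTurnWords N).card := Finset.card_filter_add_card_filter_not _
  -- the swap is a bijection `V → H`
  have hmap : ∀ {w : List Step}, w ∈ allTurnWords N → ((w.map swapL).getD 0 0).typ = 1 - (w.getD 0 0).typ := by
    intro w hw
    have hl := (mem_allTurnWords.1 hw).1
    have hw0 : 0 < w.length := by omega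
    rw [List.getD_eq_getElem _ _ (by simp [hl]; omega), List.getD_eq_getElem _ _ hw0, List.getElem_map, typ_swapL]
  have hVH : V.card ≤ H.card := by
    refine Finset.card_le_card_of_injOn (fun w => w.map swapL) (fun w hw => ?_) (fun w _ w' _ h => ?_)
    · rw [Finset.mem_coe, hV, Finset.mem_filter] at hw
      rw [Finset.mem_coe, hH, Finset.mem_filter]
      refine ⟨map_swapL_mem_allTurnWords hw.1, ?_⟩
      rw [hmap hw.1, hw.2]; decide
    · have := congrArg (List.map swapL) h
      simpa [List.map_map, Function.comp_def, swapL_swapL] using this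
  have hHV : H.card ≤ V.card := by
    refine Finset.card_le_card_of_injOn (fun w => w.map swapL) (fun w hw => ?_) (fun w _ w' _ h => ?_)
    · rw [Finset.mem_coe, hH, Finset.mem_filter] at hw
      rw [Finset.mem_coe, hV, Finset.mem_filter]
      refine ⟨map_swapL_mem_allTurnWords hw.1, ?_⟩
      have ht := Step.typ_le_one (w.getD 0 0)
      rw [hmap hw.1]; omega
    · have := congrArg (List.map swapL) h
      simpa [List.map_map, Function.comp_def, swapL_swapL] using this
  omega

/-! ### K1 `AllTurnHW` — the all-turn Hammersley–Welsh lower bound along even lengths -/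

/-- `turns 0 ω = 0`: a `0`-step walk has no internal vertex. [cite: MadrasSlade1993, §1.1] -/
private theorem turns_zero_len (ω : ℕ → Site 2) : turns 0 ω = 0 := by
  classical
  unfold turns occ
  rw [Finset.card_eq_zero, Finset.filter_eq_empty_iff]
  intro j _ h
  exact absurd h.1 (by omega)

/-- `b^{AT}(0) ≥ 1`. [cite: MadrasSlade1993, Definition 1.2.4] -/
private theorem one_le_allTurnBridgeCount_zero : 1 ≤ allTurnBridgeCount 0 := by
  classical
  have h : allTurnBridges 0 = bridges 2 0 := by
    unfold allTurnBridges
    exact Finset.filter_true_of_mem fun ω _ => by rw [turns_zero_len]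
  rw [allTurnBridgeCount, h]
  exact one_le_bridgeCount 0

/-- `μ_AT^N ≤ a(N)` for `N ≥ 1` (the infimum is below each term). [cite: MadrasSlade1993, §1.2, eq. (1.2.10)] -/
theorem muAT_pow_le_allTurnCount {N : ℕ} (hN : 1 ≤ N) : muAT ^ N ≤ (allTurnCount N : ℝ) := by
  have h := logMuAT_le (N - 1)
  rw [show N - 1 + 1 = N by omega] at h
  have hN' : ((N - 1 : ℕ) : ℝ) + 1 = N := by
    rw [Nat.cast_sub hN]; push_cast; ring
  rw [hN'] at h
  have hNpos : (0 : ℝ) < N := by exact_mod_cast hN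
  have ha : (1 : ℝ) ≤ allTurnCount N := by exact_mod_cast one_le_allTurnCount N
  have h2 : (N : ℝ) * logMuAT ≤ Real.log (allTurnCount N) := by
    have := mul_le_mul_of_nonneg_left h hNpos.le
    rwa [mul_div_cancel₀ _ hNpos.ne'] at this
  calc muAT ^ N = Real.exp ((N : ℝ) * logMuAT) := by rw [muAT, ← Real.exp_nat_mul]
    _ ≤ Real.exp (Real.log (allTurnCount N)) := Real.exp_le_exp.2 h2
    _ = allTurnCount N := Real.exp_log (by linarith)

/-- `μ_AT ≤ 4` (`a(1) ≤ 4`). [cite: MadrasSlade1993, §1.2] -/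
private theorem muAT_le_four : muAT ≤ 4 := by
  have h1 := muAT_pow_le_allTurnCount (le_refl 1)
  rw [pow_one] at h1
  have h2 : (allTurnCount 1 : ℝ) ≤ 4 := by
    have : allTurnCount 1 ≤ 4 := by
      rw [allTurnCount_eq_card_allTurnWords]
      calc (allTurnWords 1).card ≤ (words 1).card :=
            Finset.card_le_card fun w hw => mem_words.2 (mem_allTurnWords.1 hw).1
        _ = 4 := by rw [card_words]; norm_num
    exact_mod_cast this
  linarith

/-- `0 < μ_AT`. [folklore] -/
private theorem muAT_pos : 0 < muAT := Real.exp_pos _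

/-- **K1 `AllTurnHW`** — the all-turn Hammersley–Welsh lower bound along EVEN lengths:
`e^{-16√m} μ_AT^{2m} ≤ b^{AT}(2m)`.  Chain (Madras–Slade Cor. 3.1.6 inside the all-turn class):
`μ_AT^{2m-1} ≤ a(2m-1) = 2 a_V(2m-1) ≤ 2 Σ_{m' odd} h^{AT}(m'+1) h^{AT}(2m-1-m') ≤ 4m e^{6√(2m)} b^{AT}(2m)`
by S1, S4, S5 and S6. [cite: MadrasSlade1993, Corollary 3.1.6] -/
theorem allTurnHW : ∃ c : ℝ, ∀ m : ℕ, Real.exp (-(c * Real.sqrt m)) * muAT ^ (2 * m) ≤ (allTurnBridgeCount (2 * m) : ℝ) := by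
  classical
  refine ⟨16, fun m => ?_⟩
  rcases Nat.eq_zero_or_pos m with rfl | hm
  · simp only [Nat.cast_zero, Real.sqrt_zero, mul_zero, neg_zero, Real.exp_zero, pow_zero, one_mul]
    exact_mod_cast one_le_allTurnBridgeCount_zero
  set N := 2 * m - 1 with hN
  have hN1 : 1 ≤ N := by omega
  have hNodd : Odd N := ⟨m - 1, by omega⟩
  have hE : Real.exp (3 * Real.sqrt (2 * m : ℕ)) * Real.exp (3 * Real.sqrt (2 * m : ℕ)) =
      Real.exp (6 * Real.sqrt (2 * m : ℕ)) := by rw [← Real.exp_add]; ring_nf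
  set B : ℝ := (allTurnBridgeCount (2 * m) : ℝ) with hB
  have hB0 : 0 ≤ B := Nat.cast_nonneg _
  set E : ℝ := Real.exp (6 * Real.sqrt (2 * m : ℕ)) with hEdef
  have hE0 : 0 ≤ E := (Real.exp_pos _).le
  -- per-term bound
  have hterm : ∀ m' ∈ (Finset.range (N + 1)).filter Odd,
      ((allTurnHalfSpaceCount (m' + 1) * allTurnHalfSpaceCount (N - m') : ℕ) : ℝ) ≤ E * B := by
    intro m' hm'
    rw [Finset.mem_filter, Finset.mem_range] at hm'
    obtain ⟨hm'N, ⟨j, hj⟩⟩ := hm'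
    have h1 := allTurnUnfold (m' + 1)
    have h2 := allTurnUnfold (N - m')
    have hc := allTurnConcat (j + 1) (N - m')
    rw [show 2 * (j + 1) = m' + 1 by omega, show m' + 1 + (N - m') = 2 * m by omega] at hc
    have hc' : (allTurnBridgeCount (m' + 1) : ℝ) * (allTurnBridgeCount (N - m') : ℝ) ≤ B := by
      rw [hB]; exact_mod_cast hc
    have hs1 : Real.sqrt ((m' + 1 : ℕ) : ℝ) ≤ Real.sqrt ((2 * m : ℕ) : ℝ) :=
      Real.sqrt_le_sqrt (by exact_mod_cast (show m' + 1 ≤ 2 * m by omega))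
    have hs2 : Real.sqrt ((N - m' : ℕ) : ℝ) ≤ Real.sqrt ((2 * m : ℕ) : ℝ) :=
      Real.sqrt_le_sqrt (by exact_mod_cast (show N - m' ≤ 2 * m by omega))
    have he1 : Real.exp (3 * Real.sqrt ((m' + 1 : ℕ) : ℝ)) ≤ Real.exp (3 * Real.sqrt ((2 * m : ℕ) : ℝ)) :=
      Real.exp_le_exp.2 (by linarith)
    have he2 : Real.exp (3 * Real.sqrt ((N - m' : ℕ) : ℝ)) ≤ Real.exp (3 * Real.sqrt ((2 * m : ℕ) : ℝ)) :=
      Real.exp_le_exp.2 (by linarith)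
    have hb1 : (0 : ℝ) ≤ allTurnBridgeCount (m' + 1) := Nat.cast_nonneg _
    have hb2 : (0 : ℝ) ≤ allTurnBridgeCount (N - m') := Nat.cast_nonneg _
    have h1' : (allTurnHalfSpaceCount (m' + 1) : ℝ) ≤ Real.exp (3 * Real.sqrt ((2 * m : ℕ) : ℝ)) * allTurnBridgeCount (m' + 1) :=
      h1.trans (mul_le_mul_of_nonneg_right he1 hb1)
    have h2' : (allTurnHalfSpaceCount (N - m') : ℝ) ≤ Real.exp (3 * Real.sqrt ((2 * m : ℕ) : ℝ)) * allTurnBridgeCount (N - m') :=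
      h2.trans (mul_le_mul_of_nonneg_right he2 hb2)
    have hh0 : (0 : ℝ) ≤ allTurnHalfSpaceCount (m' + 1) := Nat.cast_nonneg _
    push_cast
    calc (allTurnHalfSpaceCount (m' + 1) : ℝ) * allTurnHalfSpaceCount (N - m')
        ≤ (Real.exp (3 * Real.sqrt ((2 * m : ℕ) : ℝ)) * allTurnBridgeCount (m' + 1)) *
            (Real.exp (3 * Real.sqrt ((2 * m : ℕ) : ℝ)) * allTurnBridgeCount (N - m')) :=
          mul_le_mul h1' h2' (Nat.cast_nonneg _) (by positivity)
      _ = E * ((allTurnBridgeCount (m' + 1) : ℝ) * allTurnBridgeCount (N - m')) := by rw [← hE]; ring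
      _ ≤ E * B := mul_le_mul_of_nonneg_left hc' hE0
  -- summing
  have hsum : (allTurnCountV N : ℝ) ≤ 2 * m * (E * B) := by
    have h := allTurnHWSplit N hNodd
    have h' : (allTurnCountV N : ℝ) ≤ ∑ m' ∈ (Finset.range (N + 1)).filter Odd,
        ((allTurnHalfSpaceCount (m' + 1) * allTurnHalfSpaceCount (N - m') : ℕ) : ℝ) := by exact_mod_cast h
    refine h'.trans ((Finset.sum_le_card_nsmul _ _ _ hterm).trans ?_)
    rw [nsmul_eq_mul]
    have hcard : (((Finset.range (N + 1)).filter Odd).card : ℝ) ≤ 2 * m := by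
      have : ((Finset.range (N + 1)).filter Odd).card ≤ 2 * m :=
        (Finset.card_filter_le _ _).trans (by simp; omega)
      exact_mod_cast this
    exact mul_le_mul_of_nonneg_right hcard (mul_nonneg hE0 hB0)
  -- `μ^{2m} ≤ 16 m E B`
  have hpow : muAT ^ (2 * m) ≤ 16 * m * E * B := by
    have h1 : muAT ^ N ≤ (allTurnCount N : ℝ) := muAT_pow_le_allTurnCount hN1
    have h2 : (allTurnCount N : ℝ) = 2 * allTurnCountV N := by exact_mod_cast (allTurnSwap N hN1).symm
    have h3 : muAT ^ N ≤ 2 * (2 * m * (E * B)) := by rw [h2] at h1; linarith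
    calc muAT ^ (2 * m) = muAT * muAT ^ N := by rw [← pow_succ', show N + 1 = 2 * m by omega]
      _ ≤ 4 * (2 * (2 * m * (E * B))) := mul_le_mul muAT_le_four h3 (pow_nonneg muAT_pos.le _) (by norm_num)
      _ = 16 * m * E * B := by ring
  -- the prefactor `16 m E ≤ e^{16 √m}`
  have hsq1 : (1 : ℝ) ≤ Real.sqrt m := by
    rw [show (1 : ℝ) = Real.sqrt 1 by simp]
    exact Real.sqrt_le_sqrt (by exact_mod_cast hm)
  have hexp1 : ∀ x : ℝ, 0 ≤ x → x ^ 2 ≤ Real.exp (2 * x) := by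
    intro x hx
    have := Real.add_one_le_exp x
    calc x ^ 2 ≤ (x + 1) ^ 2 := by nlinarith
      _ ≤ Real.exp x ^ 2 := by gcongr
      _ = Real.exp (2 * x) := by rw [← Real.exp_nat_mul]; norm_num
  have hm_le : (m : ℝ) ≤ Real.exp (2 * Real.sqrt m) := by
    have := hexp1 (Real.sqrt m) (Real.sqrt_nonneg _)
    rwa [Real.sq_sqrt (Nat.cast_nonneg _)] at this
  have h16 : (16 : ℝ) ≤ Real.exp (4 * Real.sqrt m) := by
    have he : (2 : ℝ) ≤ Real.exp 1 := by have := Real.add_one_le_exp (1 : ℝ); linarith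
    calc (16 : ℝ) = 2 ^ 4 := by norm_num
      _ ≤ Real.exp 1 ^ 4 := by gcongr
      _ = Real.exp 4 := by rw [← Real.exp_nat_mul]; norm_num
      _ ≤ Real.exp (4 * Real.sqrt m) := Real.exp_le_exp.2 (by linarith)
  have hE' : E ≤ Real.exp (9 * Real.sqrt m) := by
    rw [hEdef]
    refine Real.exp_le_exp.2 ?_
    have hs : Real.sqrt ((2 * m : ℕ) : ℝ) = Real.sqrt 2 * Real.sqrt m := by
      push_cast; exact Real.sqrt_mul (by norm_num) _
    have h2 : Real.sqrt 2 ≤ 3 / 2 := by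
      rw [show (3 / 2 : ℝ) = Real.sqrt ((3 / 2) ^ 2) by rw [Real.sqrt_sq]; norm_num]
      exact Real.sqrt_le_sqrt (by norm_num)
    rw [hs]
    nlinarith [Real.sqrt_nonneg (m : ℝ), Real.sqrt_nonneg (2 : ℝ)]
  have hpref : 16 * (m : ℝ) * E ≤ Real.exp (16 * Real.sqrt m) := by
    calc 16 * (m : ℝ) * E ≤ Real.exp (4 * Real.sqrt m) * Real.exp (2 * Real.sqrt m) * Real.exp (9 * Real.sqrt m) := by
          refine mul_le_mul (mul_le_mul h16 hm_le (Nat.cast_nonneg _) (Real.exp_pos _).le) hE' hE0 ?_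
          positivity
      _ = Real.exp (15 * Real.sqrt m) := by rw [← Real.exp_add, ← Real.exp_add]; ring_nf
      _ ≤ Real.exp (16 * Real.sqrt m) := Real.exp_le_exp.2 (by nlinarith)
  -- conclude
  have hfin : muAT ^ (2 * m) ≤ Real.exp (16 * Real.sqrt m) * B :=
    hpow.trans (mul_le_mul_of_nonneg_right hpref hB0)
  rw [Real.exp_neg]
  rw [inv_mul_le_iff₀ (Real.exp_pos _)]
  exact hfin

end Literature.Probability.RandomPlanarGeometry.SAW.Zd

end
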